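import Literature.AnabelianGeometry.EtaleTheta.SettingModelTateDeckLevels
import Literature.AnabelianGeometry.EtaleTheta.KummerDataOfCoreConj
import Literature.AnabelianGeometry.EtaleTheta.Discharge.Sec1Prop15iiiOfCoreGenerator
import HarnessLib

/-!
# The STAGE-2 («Tate shear») model of [EtTh] §1 (R78), F7q part 2b: the printed DISPLAYS of Prop. 1.5 (iii) AT THE
# DECK GENERATOR `σ₀ = (a, 1)` of `modelχq p 1 2`, the `Π^tp_Y` unit-moves of `η̈′`, and Prop. 1.5 (iii) at the
# Tate instance modulo the unit-move of `log(Ü)`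

S. Mochizuki, *The étale theta function and its Frobenioid-theoretic manifestations*, Publ. RIMS **45** (2009)
[EtTh], §1, Prop. 1.5 (iii), PRIMS PDF p. 23 (printed 249): "Any class `η̈^Θ ∈ H¹(Π^tp_Ÿ, Δ_Θ)` arises from a unique class
`η̈^Θ ∈ H¹((Π^tp_Ÿ)^Θ, Δ_Θ)` that maps to `log(Θ)` in the quotient `F̈⁰/F̈¹` and on which `a ∈ Z` acts as follows:
`η̈^Θ ↦ η̈^Θ − 2a·log(Ü) − (a²/2)·log(q_X) + log(O^×_K̈)`, `log(Ü) ↦ log(Ü) + a·log(q_X)/2 + log(O^×_K̈)`"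
[cite: MochizukiEtTh2009, Prop 1.5 (iii) p.23]. Layer L2 of the abc-iut cell, seat abc-iut-L2-t6 (gen 6), R78 cluster hand #4,
**F7q** part 2b. PROOF-ONLY (no definition, no instance, no `Prop` fact) over part 2a (`SettingModelTateDeckLevels`), part 1
(`SettingModelTateZClass`: the lift `x′ = zClassYddχq`, `res = log(Θ)`), abc-iut-w5-d171's F6q (`kummerCoreχq`,
`yCoordKitχq`: `log(Ü) = c^{ŷ/2}`, `conjNormal_toThetaq_eq_self`), abc-iut-L2-t12's R184 (iii) capstone
`KummerCore.prop15iii_etaleThetaDataOfClass_ofSection_of_generator`, its `ContH1.conj` bookkeeping and D2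
(`conj_kumYdd_units_ofSection`, `unitLaw_GtpY_of_generators`), and this seat's section-datum retraction
`KummerCore.kumOfSection_toKddHatOfSection`. All consumed BY NAME, nothing restated.

RESULTS. **`conj_deckGen_logUdd`** (`j = 2`, any `i`): `σ₀·log(Ü) = log(Ü)·κ(q̈)·κ(1)` = the binder `hL₀`;
**`conj_deckGen_zClassYddχq`** (`i = 1`, any even `j`): `σ₀·x′ = x′·log(Ü)^{−2}·κ(q̈)^{−1}·κ(1)` = the binder `hx₀`;
**`conj_beta_zClassYddχq`** (`β = (b^t, 1)` fixes `x′`) and **`unitLaw_GtpY_zClassYddχq`** (= the binder `hxY`, unit `1`,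
over the section datum of ANY Galois section `s`); and the capstone **`prop15iii_etaleThetaDataOfClass_etaDdχq_of_unitLaw_logUdd`**:
Prop. 1.5 (iii) HOLDS at `modelχq p 1 2` for the étale-theta datum carrying `η̈♯ = etaDdχq` over the section datum of
any `s`, GIVEN the one remaining printed input `hLY` (the `Π^tp_Y/Π^tp_Ÿ` unit-move of `log(Ü)`: at `β`,
`β·log(Ü) = log(Ü)·κ(−1)` — part 2c). At the split stage-1 model the `κ(q̈)`-terms are ABSENT (abc-iut-L2-t12's
`SettingModelChiProp15iiiSplitNegative`); the Tate shear `(κ_p, κ_p²)` produces exactly the printed ones.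
HONEST FRAMING: SEMI-SYNTHETIC model — consistency / non-vacuity evidence for the typed interface ONLY; nothing of [EtTh]
is asserted; typed ≠ proved; no side is taken on [IUTchIII] Cor. 3.12.
-/

noncomputable section

namespace Literature.AnabelianGeometry.EtaleTheta.SettingModel

open Literature.AnabelianGeometry.SemiGraphs _root_.Topology _root_.Function

variable (p : ℕ) [Fact p.Prime] (i j : ℤ)

/-- **`hL₀` at the stage-2 model** (`j = 2`, any `i`): conjugation by the deck generator `σ₀ = (a, 1)` sends
`log(Ü)` to `log(Ü)·κ(q̈)·κ(1)` — on cocycles: `ŷ(σ₀⁻¹ g σ₀)/2 = ŷ(g)/2 + κ_p(τ)`. This is the binder `hL₀` of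
abc-iut-L2-t12's `KummerCore.prop15iii_etaleThetaDataOfClass_of_generator` (with `u := 1`).
[cite: MochizukiEtTh2009, Prop 1.5 (iii) p.23] -/
theorem conj_deckGen_logUdd (hC : (ThetaSetting.modelχq p i 2 even_two).Compat) :
    haveI := hC.GtpYddTheta_normal
    ContH1.conj (MonoidHom.id (ThetaSetting.modelχq p i 2 even_two).GtpTheta)
        (ThetaSetting.modelχq p i 2 even_two).DeltaTheta
        ((ThetaSetting.modelχq p i 2 even_two).toTheta (SemidirectProduct.inl (gfpOf (FreeGroup.of 0))))
        (kummerCoreχq p i 2 even_two).logUdd =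
      (kummerCoreχq p i 2 even_two).logUdd *
        (kummerCoreχq p i 2 even_two).toKummerData.kumYdd
          ((kummerCoreχq p i 2 even_two).toKummerData.toKddHat (ThetaSetting.modelχq p i 2 even_two).qddUnit) *
        (kummerCoreχq p i 2 even_two).toKummerData.kumYdd
          ((kummerCoreχq p i 2 even_two).toKummerData.toKddHat 1) := by
  haveI := hC.GtpYddTheta_normal
  letI := (ThetaSetting.modelχq p i 2 even_two).unitsAction (kummerCoreχq p i 2 even_two).augTheta
  rw [map_one, map_one, mul_one, kumYdd_toKddHat_qddUnit_eq_mk]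
  set K := (kummerCoreχq p i 2 even_two).coeff.kummerContCocycle
    ((ThetaSetting.modelχq p i 2 even_two).GtpYdd.map (ThetaSetting.modelχq p i 2 even_two).toTheta)
    ((pRoots p).cast (pUnit_eq_toInvYdd_qddUnit p i 2 even_two))
    ((kummerCoreχq p i 2 even_two).toInvYdd (ThetaSetting.modelχq p i 2 even_two).qddUnit).2
    (fun _ => (kummerCoreχq p i 2 even_two).isOpen_stabilizer' _) with hK
  change ContH1.conj _ _ _ (ContH1.mk (yCoordKitχq p i 2 even_two).logUddFun
      (yCoordKitχq p i 2 even_two).logUddFun_mem) =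
    ContH1.mk (yCoordKitχq p i 2 even_two).logUddFun (yCoordKitχq p i 2 even_two).logUddFun_mem * ContH1.mk K.1 K.2
  rw [ContH1.mk_mul_mk]
  change ContH1.mk (ContH1.conjCocycle _ _ _ ⟨(yCoordKitχq p i 2 even_two).logUddFun,
      (yCoordKitχq p i 2 even_two).logUddFun_mem⟩).1 (ContH1.conjCocycle _ _ _
        ⟨(yCoordKitχq p i 2 even_two).logUddFun, (yCoordKitχq p i 2 even_two).logUddFun_mem⟩).2 = _
  refine ContH1.mk_congr _ (funext fun h => ?_) _ _
  obtain ⟨g, hg, hgh⟩ := h.2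
  have hg0 : gfpSnd g.left = 1 :=
    gfpSnd_left_eq_one_of_mem_gtpY_modelχq p i 2 even_two ((ThetaSetting.modelχq p i 2 even_two).GtpYdd_le_GtpY hg)
  rw [ContH1.conjCocycle_apply, MonoidHom.id_apply, Pi.mul_apply]
  refine (conjNormal_toThetaq_eq_self p i 2 even_two (SemidirectProduct.right_inl _) _).trans ?_
  apply Subtype.ext
  rw [Subgroup.coe_mul, coe_kummerContCocycle_qdd_apply]
  change ((deltaThetaCoordχq p i 2 (half ⟨yThetaχq p i 2 _, _⟩) : (CurveTheta.thetaToEll (curveχq p i 2)).ker) :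
      CurveTheta.GTheta (curveχq p i 2)) =
    ((deltaThetaCoordχq p i 2 (half ⟨yThetaχq p i 2 _, _⟩) : (CurveTheta.thetaToEll (curveχq p i 2)).ker) :
      CurveTheta.GTheta (curveχq p i 2)) * cThetaχq p i 2 (kappaP p (CurveTheta.augTheta (curveχq p i 2) h.1))
  rw [coe_deltaThetaCoordχq, coe_deltaThetaCoordχq, ← map_mul]
  congr 1
  apply sqHom_injective
  have hc : Commute (half ⟨yThetaχq p i 2 h.1, (yCoordKitχq p i 2 even_two).y_even h.1 h.2⟩)
      (kappaP p (CurveTheta.augTheta (curveχq p i 2) h.1)) :=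
    Literature.AnabelianGeometry.AbsoluteAnabelian.ZHatCompletion.mul_comm _ _
  rw [sqHom_apply, sqHom_apply, half_sq, hc.mul_pow, half_sq]
  change yThetaχq p i 2 ((MulAut.conjNormal ((ThetaSetting.modelχq p i 2 even_two).toTheta
      (SemidirectProduct.inl (gfpOf (FreeGroup.of 0))))⁻¹ h : _) : _) =
    yThetaχq p i 2 h.1 * kappaP p (CurveTheta.augTheta (curveχq p i 2) h.1) ^ 2
  rw [MulAut.conjNormal_apply, inv_inv, ← hgh]
  change yThetaχq p i 2 ((CurveTheta.toTheta (curveχq p i 2) (SemidirectProduct.inl (gfpOf (FreeGroup.of 0))))⁻¹ *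
      CurveTheta.toTheta (curveχq p i 2) g * CurveTheta.toTheta (curveχq p i 2)
        (SemidirectProduct.inl (gfpOf (FreeGroup.of 0)))) =
    yThetaχq p i 2 (CurveTheta.toTheta (curveχq p i 2) g) *
      kappaP p (CurveTheta.augTheta (curveχq p i 2) (CurveTheta.toTheta (curveχq p i 2) g)) ^ 2
  rw [← map_inv, ← map_mul, ← map_mul, yThetaχq_toTheta, yThetaχq_toTheta, CurveTheta.augTheta_toTheta,
    yCoordχq_deckConj p i 2 hg0, ← zpow_natCast]
  rfl

/-- **`hx₀` at the stage-2 model** (`i = 1`, any even `j`): conjugation by the deck generator `σ₀ = (a, 1)` sends the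
`z`-class `x′ = zClassYddχq` to `x′ · log(Ü)^{−2} · κ(q̈)^{−1} · κ(1)` — on cocycles, the `z`-part of
`σ₀⁻¹ g σ₀` is `z(g) − ŷ(g) − κ_p(τ)` (levels `(0,0,z−y−κ)`). This is the binder `hx₀` of abc-iut-L2-t12's
`KummerCore.prop15iii_etaleThetaDataOfClass_of_generator` (with `u := 1`). [cite: MochizukiEtTh2009, Prop 1.5 (iii) p.23] -/
theorem conj_deckGen_zClassYddχq (hj : Even j) (hC : (ThetaSetting.modelχq p 1 j hj).Compat) :
    haveI := hC.GtpYddTheta_normal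
    ContH1.conj (MonoidHom.id (ThetaSetting.modelχq p 1 j hj).GtpTheta) (ThetaSetting.modelχq p 1 j hj).DeltaTheta
        ((ThetaSetting.modelχq p 1 j hj).toTheta (SemidirectProduct.inl (gfpOf (FreeGroup.of 0))))
        (zClassYddχq p 1 j hj) =
      zClassYddχq p 1 j hj * (kummerCoreχq p 1 j hj).logUdd ^ (-(2 : ℤ)) *
        (kummerCoreχq p 1 j hj).toKummerData.kumYdd
          ((kummerCoreχq p 1 j hj).toKummerData.toKddHat (ThetaSetting.modelχq p 1 j hj).qddUnit) ^ (-(1 : ℤ)) *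
        (kummerCoreχq p 1 j hj).toKummerData.kumYdd ((kummerCoreχq p 1 j hj).toKummerData.toKddHat 1) := by
  haveI := hC.GtpYddTheta_normal
  letI := (ThetaSetting.modelχq p 1 j hj).unitsAction (kummerCoreχq p 1 j hj).augTheta
  rw [map_one, map_one, mul_one, kumYdd_toKddHat_qddUnit_eq_mk, zpow_neg, zpow_neg, zpow_one, zpow_two]
  set K := (kummerCoreχq p 1 j hj).coeff.kummerContCocycle
    ((ThetaSetting.modelχq p 1 j hj).GtpYdd.map (ThetaSetting.modelχq p 1 j hj).toTheta)
    ((pRoots p).cast (pUnit_eq_toInvYdd_qddUnit p 1 j hj))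
    ((kummerCoreχq p 1 j hj).toInvYdd (ThetaSetting.modelχq p 1 j hj).qddUnit).2
    (fun _ => (kummerCoreχq p 1 j hj).isOpen_stabilizer' _) with hK
  have mkinv : ∀ (f : ↥((ThetaSetting.modelχq p 1 j hj).GtpYdd.map (ThetaSetting.modelχq p 1 j hj).toTheta) →
      (ThetaSetting.modelχq p 1 j hj).DeltaTheta) (hf : f ∈ contCocycles (MonoidHom.id _)
        (ThetaSetting.modelχq p 1 j hj).DeltaTheta _),
      (ContH1.mk f hf : (ThetaSetting.modelχq p 1 j hj).H1Theta
        ((ThetaSetting.modelχq p 1 j hj).GtpYdd.map (ThetaSetting.modelχq p 1 j hj).toTheta))⁻¹ =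
        ContH1.mk f⁻¹ (inv_mem hf) := fun _ _ => rfl
  change ContH1.conj _ _ _ (ContH1.mk (zFunχq p 1 j hj _ _) (zFunχq_mem p 1 j hj _ _)) =
    ContH1.mk (zFunχq p 1 j hj _ _) (zFunχq_mem p 1 j hj _ _) *
      (ContH1.mk (yCoordKitχq p 1 j hj).logUddFun (yCoordKitχq p 1 j hj).logUddFun_mem *
        ContH1.mk (yCoordKitχq p 1 j hj).logUddFun (yCoordKitχq p 1 j hj).logUddFun_mem)⁻¹ *
      (ContH1.mk K.1 K.2)⁻¹
  rw [ContH1.mk_mul_mk, mkinv, mkinv, ContH1.mk_mul_mk, ContH1.mk_mul_mk]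
  change ContH1.mk (ContH1.conjCocycle _ _ _ ⟨zFunχq p 1 j hj _ _, zFunχq_mem p 1 j hj _ _⟩).1
      (ContH1.conjCocycle _ _ _ ⟨zFunχq p 1 j hj _ _, zFunχq_mem p 1 j hj _ _⟩).2 = _
  refine ContH1.mk_congr _ (funext fun h => ?_) _ _
  obtain ⟨g, hg, hgh⟩ := h.2
  have hg0 : gfpSnd g.left = 1 :=
    gfpSnd_left_eq_one_of_mem_gtpY_modelχq p 1 j hj ((ThetaSetting.modelχq p 1 j hj).GtpYdd_le_GtpY hg)
  rw [ContH1.conjCocycle_apply, MonoidHom.id_apply, Pi.mul_apply, Pi.mul_apply, Pi.inv_apply, Pi.inv_apply,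
    Pi.mul_apply]
  refine (conjNormal_toThetaq_eq_self p 1 j hj (SemidirectProduct.right_inl _) _).trans ?_
  apply Subtype.ext
  rw [Subgroup.coe_mul, Subgroup.coe_mul, Subgroup.coe_inv, Subgroup.coe_inv, Subgroup.coe_mul, coe_zFunχq,
    coe_zFunχq, coe_kummerContCocycle_qdd_apply]
  change zPartχq p 1 j ((MulAut.conjNormal ((ThetaSetting.modelχq p 1 j hj).toTheta
      (SemidirectProduct.inl (gfpOf (FreeGroup.of 0))))⁻¹ h : _) : _) =
    zPartχq p 1 j h.1 *
      (((deltaThetaCoordχq p 1 j (half ⟨yThetaχq p 1 j h.1, _⟩) : (CurveTheta.thetaToEll (curveχq p 1 j)).ker) :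
          CurveTheta.GTheta (curveχq p 1 j)) *
        ((deltaThetaCoordχq p 1 j (half ⟨yThetaχq p 1 j h.1, _⟩) : (CurveTheta.thetaToEll (curveχq p 1 j)).ker) :
          CurveTheta.GTheta (curveχq p 1 j)))⁻¹ *
      (cThetaχq p 1 j (kappaP p (CurveTheta.augTheta (curveχq p 1 j) h.1)))⁻¹
  rw [coe_deltaThetaCoordχq, ← map_mul, ← pow_two, half_sq, MulAut.conjNormal_apply, inv_inv]
  change zPartχq p 1 j ((CurveTheta.toTheta (curveχq p 1 j) (SemidirectProduct.inl (gfpOf (FreeGroup.of 0))))⁻¹ *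
      h.1 * CurveTheta.toTheta (curveχq p 1 j) (SemidirectProduct.inl (gfpOf (FreeGroup.of 0)))) =
    zPartχq p 1 j h.1 * (cThetaχq p 1 j (yThetaχq p 1 j h.1))⁻¹ *
      (cThetaχq p 1 j (kappaP p (CurveTheta.augTheta (curveχq p 1 j) h.1)))⁻¹
  rw [← hgh]
  change zPartχq p 1 j ((CurveTheta.toTheta (curveχq p 1 j) (SemidirectProduct.inl (gfpOf (FreeGroup.of 0))))⁻¹ *
      CurveTheta.toTheta (curveχq p 1 j) g * CurveTheta.toTheta (curveχq p 1 j)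
        (SemidirectProduct.inl (gfpOf (FreeGroup.of 0)))) =
    zPartχq p 1 j (CurveTheta.toTheta (curveχq p 1 j) g) *
      (cThetaχq p 1 j (yThetaχq p 1 j (CurveTheta.toTheta (curveχq p 1 j) g)))⁻¹ *
      (cThetaχq p 1 j (kappaP p (CurveTheta.augTheta (curveχq p 1 j) (CurveTheta.toTheta (curveχq p 1 j) g))))⁻¹
  rw [← map_inv, ← map_mul, ← map_mul, zPartχq_toTheta, zPartχq_toTheta, yThetaχq_toTheta,
    CurveTheta.augTheta_toTheta, deckConj_eq]
  exact toTheta_inl_zRepr_deckConj p j hg0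

/-- **`β = (b, 1)` FIXES the `z`-class** (any `i j`): conjugating by `β` moves only the `y`-coordinate, so the `z`-part of
`β⁻¹ g β` equals that of `g`. [cite: MochizukiEtTh2009, Prop 1.5 (iii) p.23] -/
theorem conj_beta_zClassYddχq (hj : Even j) (hC : (ThetaSetting.modelχq p i j hj).Compat) (t : ZH) :
    haveI := hC.GtpYddTheta_normal
    ContH1.conj (MonoidHom.id (ThetaSetting.modelχq p i j hj).GtpTheta) (ThetaSetting.modelχq p i j hj).DeltaTheta
        ((ThetaSetting.modelχq p i j hj).toTheta (SemidirectProduct.inl (bPowGfp t))) (zClassYddχq p i j hj) =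
      zClassYddχq p i j hj := by
  haveI := hC.GtpYddTheta_normal
  change ContH1.conj _ _ _ (ContH1.mk (zFunχq p i j hj _ _) (zFunχq_mem p i j hj _ _)) =
    ContH1.mk (zFunχq p i j hj _ _) (zFunχq_mem p i j hj _ _)
  change ContH1.mk (ContH1.conjCocycle _ _ _ ⟨zFunχq p i j hj _ _, zFunχq_mem p i j hj _ _⟩).1
      (ContH1.conjCocycle _ _ _ ⟨zFunχq p i j hj _ _, zFunχq_mem p i j hj _ _⟩).2 = _
  refine ContH1.mk_congr _ (funext fun h => ?_) _ _
  obtain ⟨g, hg, hgh⟩ := h.2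
  have hg0 : gfpSnd g.left = 1 :=
    gfpSnd_left_eq_one_of_mem_gtpY_modelχq p i j hj ((ThetaSetting.modelχq p i j hj).GtpYdd_le_GtpY hg)
  rw [ContH1.conjCocycle_apply, MonoidHom.id_apply]
  refine (conjNormal_toThetaq_eq_self p i j hj (SemidirectProduct.right_inl _) _).trans ?_
  apply Subtype.ext
  rw [coe_zFunχq, coe_zFunχq]
  change zPartχq p i j ((MulAut.conjNormal ((ThetaSetting.modelχq p i j hj).toTheta
      (SemidirectProduct.inl (bPowGfp t)))⁻¹ h : _) : _) = zPartχq p i j h.1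
  rw [MulAut.conjNormal_apply, inv_inv]
  change zPartχq p i j ((CurveTheta.toTheta (curveχq p i j) (SemidirectProduct.inl (bPowGfp t)))⁻¹ * h.1 *
      CurveTheta.toTheta (curveχq p i j) (SemidirectProduct.inl (bPowGfp t))) = zPartχq p i j h.1
  rw [← hgh]
  change zPartχq p i j ((CurveTheta.toTheta (curveχq p i j) (SemidirectProduct.inl (bPowGfp t)))⁻¹ *
      CurveTheta.toTheta (curveχq p i j) g * CurveTheta.toTheta (curveχq p i j) (SemidirectProduct.inl (bPowGfp t))) =
    zPartχq p i j (CurveTheta.toTheta (curveχq p i j) g)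
  rw [← map_inv, ← map_mul, ← map_mul, zPartχq_toTheta, zPartχq_toTheta, inl_inv_mul_mul_inl]
  have hγ' : gfpSnd ((bPowGfp t)⁻¹ * g.left * actχq p i j g.right (bPowGfp t)) = 1 := by
    rw [map_mul, map_mul, map_inv, gfpSnd_actχq, hg0, gfpSnd_bPowGfp, inv_one, mul_one, mul_one]
  refine toThetaq_eq_of_right_eq_one p i j _ _ (SemidirectProduct.right_inl _) (SemidirectProduct.right_inl _) ?_
  rw [SemidirectProduct.left_inl, SemidirectProduct.left_inl, mem_closure_commutator₃_iff_forall_hHat]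
  intro N
  rw [map_mul (hHat N), map_inv (hHat N), hHat_gfpFst_mul_bPowGfp_inv N hγ', hHat_gfpFst_mul_bPowGfp_inv N hg0,
    hHat_gfpFst_bConjLeft p i j N _ _ hg0]
  ext <;> simp

/-- **`hxY` at the stage-2 model** (any `i j`, any Galois section `s` for the section datum): every `y ∈ Π^tp_Y` fixes
the `z`-class up to a unit class — in fact ON THE NOSE (`u = 1`), by abc-iut-L2-t12's generator reduction
(`KummerData.unitLaw_GtpY_of_generators` with `S = {β}`, `Π^tp_Ÿ` acting trivially).
[cite: MochizukiEtTh2009, Prop 1.5 (iii) p.23] -/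
theorem unitLaw_GtpY_zClassYddχq (hj : Even j) (hC : (ThetaSetting.modelχq p i j hj).Compat)
    (s : GQp p →* (ThetaSetting.modelχq p i j hj).PiTemp) (hs : Continuous s)
    (hsec : ∀ σ : GQp p, (ThetaSetting.modelχq p i j hj).aug (s σ) = σ)
    (hsY : (ThetaSetting.modelχq p i j hj).GK.map s ≤ (ThetaSetting.modelχq p i j hj).GtpY)
    (hsYdd : (ThetaSetting.modelχq p i j hj).GKdd.map s ≤ (ThetaSetting.modelχq p i j hj).GtpYdd) :
    haveI := hC.GtpYddTheta_normal
    ∀ y ∈ (ThetaSetting.modelχq p i j hj).GtpY, ∃ u ∈ (ThetaSetting.modelχq p i j hj).unitsOKdd,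
      ContH1.conj (MonoidHom.id (ThetaSetting.modelχq p i j hj).GtpTheta) (ThetaSetting.modelχq p i j hj).DeltaTheta
          ((ThetaSetting.modelχq p i j hj).toTheta y) (zClassYddχq p i j hj) =
        zClassYddχq p i j hj *
          ((kummerCoreχq p i j hj).toKummerDataOfSection s hs hsec hsY hsYdd).kumYdd
            (((kummerCoreχq p i j hj).toKummerDataOfSection s hs hsec hsY hsYdd).toKddHat u) := by
  haveI := hC.GtpYddTheta_normal
  refine ((kummerCoreχq p i j hj).toKummerDataOfSection s hs hsec hsY hsYdd).unitLaw_GtpY_of_generators hC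
    (zClassYddχq p i j hj) ((kummerCoreχq p i j hj).conj_kumYdd_units_ofSection s hs hsec hsY hsYdd hC)
    {(SemidirectProduct.inl (bPowGfp (iotaZ (Multiplicative.ofAdd 1))) : PiTpχq p i j)}
    (GtpY_le_closure_beta_GtpYdd p i j hj) ?_
  intro y hy
  rw [Set.mem_singleton_iff] at hy
  subst hy
  refine ⟨1, (ThetaSetting.modelχq p i j hj).unitsOKdd.one_mem, ?_⟩
  have h1 : ((kummerCoreχq p i j hj).toKummerDataOfSection s hs hsec hsY hsYdd).toKddHat 1 = 1 := map_one _
  have h2 : ((kummerCoreχq p i j hj).toKummerDataOfSection s hs hsec hsY hsYdd).kumYdd 1 = 1 := map_one _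
  rw [h1, h2, mul_one]
  exact conj_beta_zClassYddχq p i j hj hC _

/-- The section-datum Kummer classes ARE the core's (re-export of abc-iut-L2-t6's retraction at `modelχq`).
[cite: MochizukiEtTh2009, Prop 1.5 p.23] -/
theorem kumYdd_toKddHat_ofSection_modelχq (hj : Even j)
    (s : GQp p →* (ThetaSetting.modelχq p i j hj).PiTemp) (hs : Continuous s)
    (hsec : ∀ σ : GQp p, (ThetaSetting.modelχq p i j hj).aug (s σ) = σ)
    (hsY : (ThetaSetting.modelχq p i j hj).GK.map s ≤ (ThetaSetting.modelχq p i j hj).GtpY)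
    (hsYdd : (ThetaSetting.modelχq p i j hj).GKdd.map s ≤ (ThetaSetting.modelχq p i j hj).GtpYdd)
    (v : (↥(ThetaSetting.modelχq p i j hj).Kdd)ˣ) :
    ((kummerCoreχq p i j hj).toKummerDataOfSection s hs hsec hsY hsYdd).kumYdd
        (((kummerCoreχq p i j hj).toKummerDataOfSection s hs hsec hsY hsYdd).toKddHat v) =
      (kummerCoreχq p i j hj).toKummerData.kumYdd ((kummerCoreχq p i j hj).toKummerData.toKddHat v) :=
  (kummerCoreχq p i j hj).kumOfSection_toKddHatOfSection s hs hsec hsYdd v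

/-- **[EtTh] Prop. 1.5 (iii) HOLDS at the stage-2 model `modelχq p 1 2` for the étale-theta datum carrying the
`z`-class `η̈♯ = etaDdχq`** over the section Kummer datum of ANY Galois section `s`, GIVEN the single remaining
printed input `hLY` — the `Π^tp_Y/Π^tp_Ÿ` unit-move of `log(Ü)` ("`log(Ü) ↦ log(Ü) + log(O^×_K̈)`", here the unit
`−1`: `β·log(Ü) = log(Ü) + (χ−1)/2 = log(Ü) + κ(−1)`). Everything else — the lift `x′ = zClassYddχq` with
`res = log(Θ)`, the two deck displays at `σ₀ = (a, 1)` (`hL₀`, `hx₀`, unit `1`), the unit-moves of `x′` (`hxY`, unit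
`1`) — is PROVED above; the Kummer-side inputs are abc-iut-L2-t12's theorems. [cite: MochizukiEtTh2009, Prop 1.5 (iii) p.23] -/
theorem prop15iii_etaleThetaDataOfClass_etaDdχq_of_unitLaw_logUdd
    (hC : (ThetaSetting.modelχq p 1 2 even_two).Compat)
    (s : GQp p →* (ThetaSetting.modelχq p 1 2 even_two).PiTemp) (hs : Continuous s)
    (hsec : ∀ σ : GQp p, (ThetaSetting.modelχq p 1 2 even_two).aug (s σ) = σ)
    (hsY : (ThetaSetting.modelχq p 1 2 even_two).GK.map s ≤ (ThetaSetting.modelχq p 1 2 even_two).GtpY)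
    (hsYdd : (ThetaSetting.modelχq p 1 2 even_two).GKdd.map s ≤ (ThetaSetting.modelχq p 1 2 even_two).GtpYdd)
    (hLY : haveI := hC.GtpYddTheta_normal
      ∀ y ∈ (ThetaSetting.modelχq p 1 2 even_two).GtpY, ∃ u ∈ (ThetaSetting.modelχq p 1 2 even_two).unitsOKdd,
        ContH1.conj (MonoidHom.id (ThetaSetting.modelχq p 1 2 even_two).GtpTheta)
            (ThetaSetting.modelχq p 1 2 even_two).DeltaTheta ((ThetaSetting.modelχq p 1 2 even_two).toTheta y)
            (kummerCoreχq p 1 2 even_two).logUdd =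
          (kummerCoreχq p 1 2 even_two).logUdd *
            ((kummerCoreχq p 1 2 even_two).toKummerDataOfSection s hs hsec hsY hsYdd).kumYdd
              (((kummerCoreχq p 1 2 even_two).toKummerDataOfSection s hs hsec hsY hsYdd).toKddHat u)) :
    ThetaSetting.Prop15iii
      (((kummerCoreχq p 1 2 even_two).toKummerDataOfSection s hs hsec hsY hsYdd).etaleThetaDataOfClass
        (etaDdχq p 1 2 even_two)) hC := by
  haveI := hC.GtpYddTheta_normal
  have e := kumYdd_toKddHat_ofSection_modelχq p 1 2 even_two s hs hsec hsY hsYdd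
  refine (kummerCoreχq p 1 2 even_two).prop15iii_etaleThetaDataOfClass_ofSection_of_generator s hs hsec hsY hsYdd
    hC (etaDdχq p 1 2 even_two) (zClassYddχq p 1 2 even_two) rfl (res_zClassYddχq_eq_logTheta p 1 2 even_two hC)
    (toZ_inl_gfpOf_a p 1 2 even_two) ?_ hLY ?_ (unitLaw_GtpY_zClassYddχq p 1 2 even_two hC s hs hsec hsY hsYdd)
  · refine ⟨1, (ThetaSetting.modelχq p 1 2 even_two).unitsOKdd.one_mem, ?_⟩
    rw [e, e]
    exact conj_deckGen_logUdd p 1 hC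
  · refine ⟨1, (ThetaSetting.modelχq p 1 2 even_two).unitsOKdd.one_mem, ?_⟩
    rw [e, e]
    exact conj_deckGen_zClassYddχq p 2 even_two hC

end Literature.AnabelianGeometry.EtaleTheta.SettingModel

end
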